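import Summits.ValiantsHypothesis.ValiantsHypothesis.Theses.PolyaContinued

/-!
# Line `monotone_split` for the crux `PfaffianCoverHard` (item stmt-ValiantsHypothesis-7420, route PolyaContinued)

Crux-strategist output (a)+(b): the TYPED DECOMPOSITION of the deciding crux along the monotone seam,
registered as a skeleton line. Two stubs, both genuine cruxes of the route (neither restates the crux or
the summit — BC2 probes `stub → PfaffianCoverHard`, `stub → ValiantsHypothesis` fail, see
`bc/*_probe.lean` in the strategist folder / NOTES):

* `stub_monotoneCoverHard` = route item `MonotoneCoverHard` (stmt-ValiantsHypothesis-7421, rank 2): no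
  quasi-polynomial label-bijective (constants `0/1`) Pfaffian cover of `per_n`;
* `stub_coverDecancellation` = route item `CoverDecancellation` (stmt-ValiantsHypothesis-17819, rank 3):
  decancellation for the permanent at quasi-polynomial cost, uniformly in the cover size `m`.

`monotoneSplit_composition : stub₁-statement → stub₂-statement → (PfaffianCoverHard, unfolded)` is proved
sorry-free (qp ∘ qp = qp: `decancellation_exponent_le`), and `PfaffianCoverHard_of : PfaffianCoverHard`
concludes the crux BY NAME from the two stubs. The composition, as a Theorems file, is attached as evidence
on stmt-7420 for a prover to land (`Theorems/` is prover-only).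
-/

set_option linter.dupNamespace false

namespace Summit.ValiantsHypothesis.ValiantsHypothesis.Cruxes.PfaffianCoverHard.MonotoneSplit

open Literature.Computability.AlgebraicComplexity
open Summit.ValiantsHypothesis.ValiantsHypothesis.Theses.PolyaContinued

/-- STUB 1 (= item stmt-ValiantsHypothesis-7421 `MonotoneCoverHard`, XL): the monotone shadow — no
quasi-polynomial Pfaffian bipartite graph has its perfect matchings in label-bijection with `S_n`. -/
theorem stub_monotoneCoverHard : MonotoneCoverHard := by
  sorry

/-- STUB 2 (= item stmt-ValiantsHypothesis-17819 `CoverDecancellation`, L): decancellation for the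
permanent at quasi-polynomial cost — every Pfaffian cover of `per_n` of size `m` with complex constants
converts into a `0/1` cover of size `≤ 2^((log₂ m + c)^c)`, `c` uniform. -/
theorem stub_coverDecancellation : CoverDecancellation := by
  sorry

/-- Exponent bookkeeping (`qp ∘ qp = qp`): if `m ≤ 2^((L + c₀)^c₀)` then
`(Nat.log 2 m + c)^c ≤ (L + K)^K` with `K = (c₀ + 2) * c + c₀ + c + 2`. -/
theorem decancellation_exponent_le (L c₀ c m : ℕ) (hm : m ≤ 2 ^ ((L + c₀) ^ c₀)) :
    (Nat.log 2 m + c) ^ c ≤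
      (L + ((c₀ + 2) * c + c₀ + c + 2)) ^ ((c₀ + 2) * c + c₀ + c + 2) := by
  set A := (L + c₀) ^ c₀ with hA
  set K := (c₀ + 2) * c + c₀ + c + 2 with hK
  have hlog : Nat.log 2 m ≤ A := by
    calc Nat.log 2 m ≤ Nat.log 2 (2 ^ A) := Nat.log_mono_right hm
      _ = A := Nat.log_pow Nat.one_lt_two _
  set D := L + c₀ + c + 2 with hD
  have hD2 : 2 ≤ D := by omega
  have hD1 : 1 ≤ D := by omega
  have hAD : A ≤ D ^ (c₀ + 1) := by
    calc A = (L + c₀) ^ c₀ := hA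
      _ ≤ D ^ c₀ := Nat.pow_le_pow_left (by omega) c₀
      _ ≤ D ^ c₀ * D := Nat.le_mul_of_pos_right _ (by omega)
      _ = D ^ (c₀ + 1) := (pow_succ D c₀).symm
  have hcD : c ≤ D ^ (c₀ + 1) := by
    calc c ≤ D := by omega
      _ ≤ D ^ (c₀ + 1) := Nat.le_self_pow (by omega) D
  have hbase : Nat.log 2 m + c ≤ D ^ (c₀ + 2) := by
    calc Nat.log 2 m + c ≤ D ^ (c₀ + 1) + D ^ (c₀ + 1) := Nat.add_le_add (le_trans hlog hAD) hcD
      _ = 2 * D ^ (c₀ + 1) := (two_mul _).symm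
      _ ≤ D * D ^ (c₀ + 1) := Nat.mul_le_mul_right _ hD2
      _ = D ^ (c₀ + 2) := by rw [mul_comm, ← pow_succ]
  have hDK : D ≤ L + K := by
    have : c₀ + c + 2 ≤ K := by rw [hK]; omega
    omega
  have hLK : 1 ≤ L + K := le_trans hD1 hDK
  calc (Nat.log 2 m + c) ^ c ≤ (D ^ (c₀ + 2)) ^ c := Nat.pow_le_pow_left hbase c
    _ = D ^ ((c₀ + 2) * c) := by rw [← pow_mul]
    _ ≤ (L + K) ^ ((c₀ + 2) * c) := Nat.pow_le_pow_left hDK _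
    _ ≤ (L + K) ^ K := Nat.pow_le_pow_right hLK (by rw [hK]; omega)

/-- COMPOSITION (kernel-checked, no sorry): stub 1 ∧ stub 2 ⟹ the crux (conclusion = `PfaffianCoverHard`
unfolded, so that the hypothesis-free `PfaffianCoverHard_of` below is the file's only theorem concluding the
crux by name). Were there Pfaffian covers of `per_n` of size `≤ 2^((log₂ n + c₀)^c₀)` for all `n`, stub 2
would turn each into a `0/1` cover of size `≤ 2^((log₂ n + K)^K)`, `K = (c₀ + 2)c + c₀ + c + 2`,
contradicting stub 1. -/
theorem monotoneSplit_composition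
    (hMono : MonotoneCoverHard)
    (hDec : CoverDecancellation) :
    ¬ ∃ c : ℕ, ∀ n : ℕ, ∃ m : ℕ, m ≤ 2 ^ ((Nat.log 2 n + c) ^ c) ∧ ∃ (E : Finset (Fin m × Fin m)) (P : MvPolynomial (Fin m × Fin m) ℂ), P = (Matrix.of fun i j => if (i, j) ∈ E then MvPolynomial.X (i, j) else 0 : Matrix (Fin m) (Fin m) (MvPolynomial (Fin m × Fin m) ℂ)).permanent ∧ (∃ s : Fin m × Fin m → ℂ, (∀ e, s e = 1 ∨ s e = -1) ∧ (Matrix.of fun i j => if (i, j) ∈ E then MvPolynomial.C (s (i, j)) * MvPolynomial.X (i, j) else 0 : Matrix (Fin m) (Fin m) (MvPolynomial (Fin m × Fin m) ℂ)).det = P) ∧ Literature.Computability.AlgebraicComplexity.IsProjection (Literature.Computability.AlgebraicComplexity.perPoly (Fin n) ℂ) P := by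
  intro hX
  obtain ⟨c₀, hc₀⟩ := hX
  obtain ⟨c, hc⟩ := hDec
  apply hMono
  refine ⟨(c₀ + 2) * c + c₀ + c + 2, fun n => ?_⟩
  obtain ⟨m, hm, E, P, hP, hs, hproj⟩ := hc₀ n
  obtain ⟨m', hm', E', P', hP', hs', a, ha, hper⟩ := hc n m ⟨E, P, hP, hs, hproj⟩
  exact ⟨m', le_trans hm' (Nat.pow_le_pow_right Nat.two_pos
    (decancellation_exponent_le (Nat.log 2 n) c₀ c m hm)), E', P', hP', hs', a, ha, hper⟩

/-- THE LINE CONCLUDES THE CRUX BY NAME (modulo the two declared stubs). -/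
theorem PfaffianCoverHard_of :
    Summit.ValiantsHypothesis.ValiantsHypothesis.Theses.PolyaContinued.PfaffianCoverHard :=
  monotoneSplit_composition stub_monotoneCoverHard stub_coverDecancellation

end Summit.ValiantsHypothesis.ValiantsHypothesis.Cruxes.PfaffianCoverHard.MonotoneSplit
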